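import Summits.CriticalPhenomena.PercolationContinuityZ3.Theorems.PercNearOneGluingNoHeavyLowerTailHybridThreePointLB
import Summits.CriticalPhenomena.PercolationContinuityZ3.Theorems.PercNearOneGluingNoHeavyLowerTailE3FourPointClassesAllGraphs
import HarnessLib

/-!
# `NoHeavyLowerTail` (crux stmt-CriticalPhenomena-4575): E3GRP rows PROVED on every finite weighted graph by the HYBRID three-point lower
# bound — four-point class `(iii)` (= `E1`) and the five-terminal row `r3`

Support file (prover prim-cert-2 gen 9; `--supports stmt-CriticalPhenomena-4575`).  No definitions, no named facts, no sorries, no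
`native_decide`.

Corollaries of `HybridThreePointLB.sahiE3_hybrid_nonneg` (`0 ≤ E₃({P₁ ≁ c}, {c ≁ P₃}, {P₁ ≁ P₃′})` for every finite weighted graph, vertex
`c`, vertex sets `P₁`, `P₃ ⊆ P₃′`; prim-ineq-gen-8 THEOREM-HYBRID-3PTLB, formalised in `…HybridThreePointLB*`) that need the HYBRID form
`P₃ ⊊ P₃′` — the equal-pole instances (class `(b)`, rows `r0, r1, r2`, `E3GRPb 1`) were landed minutes earlier by prim-ineq-prove-3 from its
`GroupThreePointLB.sahiE3_groupPairSep_nonneg` (`…GroupThreePointLBRows`: `rowHolds4_two_all`, `rowHolds_zero/one/two_all`).  Vocabulary of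
`…E3GroupSepLeFive` (`RowHolds i`, terminals `(o, a₁, a₂, a₃, b)`) and `…E3FourPointClassesLeFive` (`Row4Holds i`, terminals `(a, b, c, y)`),
for EVERY `n`, every weight vector, every terminal tuple (no distinctness needed):
* `rowHolds4_zero_all` — class `(iii) = E₃(D[a|b], D[a|c], D[b|cy]) ≥ 0` (= harness-2's `E1`, "the only conjectural four-point input of the
  SHK3⁺ Bernstein step", PLAN-lead amendment gen 7): middle pole `a`, `P₁ = {b}`, `P₃ = {c} ⊆ P₃′ = {c, y}`;
* `rowHolds_three_all` — **`r3 = E₃(D[a₁|b], D[a₂a₃|b], D[oa₂a₃|a₁]) ≥ 0`** (the single "biting" `|A| = 5` E3GRP instance of MASTER-FAMILY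
  'UPDATE 18:05Z'): pole `b`, `P₁ = {a₁}`, `P₃ = {a₂,a₃} ⊆ P₃′ = {o,a₂,a₃}`;
* dictionary `connEvent_sep_eq`, `connEvent_sep_eq_flip`, `connEvent_sep_singleton_left/right` (`sep` events with finset quantifiers).
Status of the seven four-point classes on general graphs after this file and `…GroupThreePointLBRows` / `…E3FourPointClassesAllGraphs`:
`(iii), (ii), (b), F` PROVED for every `n`; the increasing classes `α, β, γ` open (`γ` ⟸ four-point `AG⁺`, `rowHolds4_six_of_agPlus`).  Of the
nine five-terminal rows: `r0 … r3` proved, `r4 … r8` (increasing) open.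
-/

noncomputable section

namespace Summit.CriticalPhenomena.PercolationContinuityZ3.Theorems

namespace E3GroupSepCert

open MeasureTheory Set CovTransferCert
open Literature.Probability.Percolation Literature.Probability.LatticeModels

variable {n : ℕ}

/-! ### `sep` events as group separations -/

/-- `D[X|Y]` with finset-indexed quantifiers. [this work] -/
theorem connEvent_sep_eq (X Y : List (Fin n)) :
    connEvent (sep X Y) = {ω : BondConfig (Fin n) | ∀ x ∈ X.toFinset, ∀ y ∈ Y.toFinset, ω ∉ openConn x y} := by
  rw [connEvent_sep]; ext ω; simp only [mem_setOf_eq, List.mem_toFinset]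

/-- `D[X|Y]` read from the `Y` side. [this work] -/
theorem connEvent_sep_eq_flip (X Y : List (Fin n)) :
    connEvent (sep X Y) = {ω : BondConfig (Fin n) | ∀ y ∈ Y.toFinset, ∀ x ∈ X.toFinset, ω ∉ openConn y x} := by
  rw [connEvent_sep]; ext ω; simp only [mem_setOf_eq, List.mem_toFinset]
  constructor
  · intro h y hy x hx; rw [KNPreFKG.openConn_symm]; exact h x hx y hy
  · intro h x hx y hy; rw [KNPreFKG.openConn_symm]; exact h y hy x hx

/-- `D[c|Y]` for a single vertex `c`. [this work] -/
theorem connEvent_sep_singleton_left (c : Fin n) (Y : List (Fin n)) :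
    connEvent (sep [c] Y) = {ω : BondConfig (Fin n) | ∀ y ∈ Y.toFinset, ω ∉ openConn c y} := by
  rw [connEvent_sep_eq]; ext ω; simp

/-- `D[X|c]` for a single vertex `c`, read from `c`. [this work] -/
theorem connEvent_sep_singleton_right (X : List (Fin n)) (c : Fin n) :
    connEvent (sep X [c]) = {ω : BondConfig (Fin n) | ∀ x ∈ X.toFinset, ω ∉ openConn c x} := by
  rw [connEvent_sep_eq_flip]; ext ω; simp

/-! ### Four-point class `(iii)` for every `n` -/

/-- **Class `(iii)` (row `0`, = `E1`) on EVERY finite weighted graph**: `E₃(D[a|b], D[a|c], D[b|cy]) ≥ 0` for all `n`, `w`, `a b c y`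
(hybrid 3PT-LB with middle pole `a`, `P₁ = {b}`, `P₃ = {c} ⊆ P₃′ = {c,y}`). [this work] -/
theorem rowHolds4_zero_all (w : Sym2 (Fin n) → unitInterval) (a b c y : Fin n) : Row4Holds 0 w (a, b, c, y) := by
  have hr : row4 0 (a, b, c, y) = (sep [a] [b], sep [a] [c], sep [b] [c, y]) := rfl
  unfold Row4Holds
  rw [hr, e3Ineq_iff_sahiE3_nonneg, connEvent_sep_singleton_left a [b], connEvent_sep_singleton_left a [c],
    connEvent_sep_eq_flip [b] [c, y]]
  exact HybridThreePointLB.sahiE3_hybrid_nonneg w a [b].toFinset [c].toFinset [c, y].toFinset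
    (fun x hx => by rw [List.mem_toFinset] at hx ⊢; simp only [List.mem_cons] at hx ⊢; tauto)

/-! ### The five-terminal E3GRP row `r3` for every `n` -/

/-- **Row `r3 = E₃(D[a₁|b], D[a₂a₃|b], D[oa₂a₃|a₁])` on EVERY finite weighted graph** — the single "biting" `|A| = 5` E3GRP instance of
the SHK3⁺ Bernstein step (MASTER-FAMILY, 2026-08-19) — by the hybrid 3PT-LB with pole `b`, `P₁ = {a₁}`, `P₃ = {a₂,a₃} ⊆ P₃′ = {o,a₂,a₃}`.
[this work] -/
theorem rowHolds_three_all (w : Sym2 (Fin n) → unitInterval) (t : Tup n) : RowHolds 3 w t := by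
  obtain ⟨o, a₁, a₂, a₃, b⟩ := t
  have hr : row 3 (o, a₁, a₂, a₃, b) = (sep [a₁] [b], sep [a₂, a₃] [b], sep [o, a₂, a₃] [a₁]) := rfl
  unfold RowHolds
  rw [hr, e3Ineq_iff_sahiE3_nonneg, connEvent_sep_singleton_right [a₁] b, connEvent_sep_singleton_right [a₂, a₃] b,
    connEvent_sep_eq [o, a₂, a₃] [a₁]]
  exact HybridThreePointLB.sahiE3_hybrid_nonneg w b [a₁].toFinset [a₂, a₃].toFinset [o, a₂, a₃].toFinset
    (fun x hx => by rw [List.mem_toFinset] at hx ⊢; simp only [List.mem_cons] at hx ⊢; tauto)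

end E3GroupSepCert

end Summit.CriticalPhenomena.PercolationContinuityZ3.Theorems

end
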